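import Literature.AnabelianGeometry.EtaleTheta.KummerClass
import Summits.ABC.IUTFork.LanaLocalField
import HarnessLib

/-!
# L-LANA objects XII: the Kummer map of `K̄_v^×` at a nonarchimedean place (LANA §4.2 (b), §6.1; N13 CONSUMED)

Record-only file (D-0012) of the abc-iut cell (seat abc-iut-c312-4, L-LANA level; CONSUMES seat
abc-iut-L2-t3's `Literature/AnabelianGeometry/EtaleTheta/KummerClass.lean` = LLANA-SPEC N13 at level `H`);
TAKES NO SIDE on [IUTchIII] Cor. 3.12. LANA §4.2 (b) p. 26 lists among the objects reconstructed from
`Π_v`: "The embedding `K_v^× = (K̄_v^×)^{G_v} ↪ H¹(Π_v, Λ(O^×_v))` by Kummer theory", and §6.1 p. 31 builds, for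
`G ↷ M` with `M^{gp}` `n`-divisible, "`M^H → (M^{gp})^H → H¹(H, Λ(M))`". Over the CONSTRUCTED place datum of
`LanaLocalField` (`K̄_v = AlgCl K_v` with `G_v = Gal(K̄_v/K_v)`), this file supplies the two inputs L2-t3's
Kummer class needs and instantiates it:

* `AlgCl.unitsAction` — `G_v ↷ K̄_v^×` by group automorphisms (restriction of the field action);
* `AlgCl.rootableUnits` — `K̄_v^×` is ROOTABLE (`n`-divisible for all `n ≥ 1`: `K̄_v` is algebraically
  closed, Mathlib `IsAlgClosed.exists_pow_nat_eq`) = hypothesis (a) of §6.1;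
* `AlgCl.kummerAt H : ((K̄_v^×)^H, ·) → H¹(H, Λ(K̄_v^×))` := L2-t3's `kummerMapFixed` — a homomorphism
  (PROVED there), for every subgroup `H ≤ G_v`; with `H = G_v` and characteristic `0`, the source
  `(K̄_v^×)^{G_v}` is `K_v^×` (`AlgCl.mem_unitsInvariants_top_iff`, from `LanaLocalField.fixed_iff_mem_range`),
  i.e. LANA's "`K_v^× = (K̄_v^×)^{G_v} → H¹(G_v, Λ)`".

Modelling notes. (i) Coefficients: LANA writes `Λ(O^×_v)`; the torsion of `K̄_v^×` lies in `O^×_v`, so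
`Λ(K̄_v^×) = Λ(O^×_v)` as groups — here the cyclotome of `A = K̄_v^×` is used directly (L2-t3's `cyclotome A`).
(ii) `H¹(Π_v, –)` is obtained from `H¹(G_v, –)` by inflation along `Π_v ↠ G_v`; not typed here. (iii)
INJECTIVITY ("embedding") is classical Kummer theory (`∩_n (K_v^×)^n = 1`) and is NOT proved here.
[cite: LANA2026Report, §4.2 (b) p. 26, §6.1 p. 31] NOT here: any judgement.
-/

noncomputable section

namespace Summit.ABC
namespace IUTFork
namespace AlgCl

open Literature.AnabelianGeometry.EtaleTheta
open scoped NNReal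

section Units

variable (K₀ : Type) [NontriviallyNormedField K₀]

/-- `K̄_v` is algebraically closed (Mathlib's instance, transported to the synonym). [folklore] -/
instance instIsAlgClosed : IsAlgClosed (AlgCl K₀) := inferInstanceAs (IsAlgClosed (AlgebraicClosure K₀))

/-- **`G_v ↷ K̄_v^×`** by group automorphisms: the field action restricted to units.
[cite: LANA2026Report, §4.2 (b) p. 26] -/
instance unitsAction : MulDistribMulAction (Gal K₀) (AlgCl K₀)ˣ where
  smul σ u := Units.map (MulDistribMulAction.toMonoidHom (AlgCl K₀) σ) u
  one_smul u := Units.ext (one_smul (Gal K₀) (u : AlgCl K₀))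
  mul_smul σ τ u := Units.ext (mul_smul σ τ (u : AlgCl K₀))
  smul_mul σ u v := Units.ext (smul_mul' σ (u : AlgCl K₀) (v : AlgCl K₀))
  smul_one σ := Units.ext (smul_one σ)

/-- The action on units, on underlying elements. [cite: LANA2026Report, §4.2 (b) p. 26] -/
@[simp] theorem units_coe_smul (σ : Gal K₀) (u : (AlgCl K₀)ˣ) :
    ((σ • u : (AlgCl K₀)ˣ) : AlgCl K₀) = σ • (u : AlgCl K₀) := rfl

/-- **Hypothesis (a) of §6.1 DISCHARGED**: `K̄_v^×` is rootable — every unit has an `n`-th root for every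
`n ≥ 1` (`K̄_v` is algebraically closed). [cite: LANA2026Report, §6.1 (a) p. 31] -/
instance rootableUnits : RootableBy (AlgCl K₀)ˣ ℕ where
  root u n := if hn : n = 0 then 1 else
    Units.mk0 (Classical.choose (IsAlgClosed.exists_pow_nat_eq (u : AlgCl K₀) (Nat.pos_of_ne_zero hn)))
      (by
        intro h0
        have h := Classical.choose_spec (IsAlgClosed.exists_pow_nat_eq (u : AlgCl K₀) (Nat.pos_of_ne_zero hn))
        rw [h0, zero_pow hn] at h
        exact u.ne_zero h.symm)
  root_zero u := by simp
  root_cancel {n} u hn := by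
    simp only [hn, ↓reduceDIte]
    ext
    rw [Units.val_pow_eq_pow_val, Units.val_mk0]
    exact Classical.choose_spec (IsAlgClosed.exists_pow_nat_eq (u : AlgCl K₀) (Nat.pos_of_ne_zero hn))

/-- **The Kummer map at level `H ≤ G_v`** (§6.1: "`M^H → (M^{gp})^H → H¹(H, Λ(M))`") for `M^{gp} = K̄_v^×`:
L2-t3's `kummerMapFixed`, a homomorphism from the (multiplicative) invariants to Mathlib's
`groupCohomology.H1` of the `H`-module `Λ(K̄_v^×)`. [cite: LANA2026Report, §6.1 p. 31, §4.2 (b) p. 26] -/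
def kummerAt (H : Subgroup (Gal K₀)) :
    Additive (invariants (A := (AlgCl K₀)ˣ) H) →+ groupCohomology.H1 (cyclotomeRep (A := (AlgCl K₀)ˣ) H) :=
  kummerMapFixed H

/-- `κ(ab) = κ(a) + κ(b)` (L2-t3 `kummerClass_mul`, restated for the place datum).
[cite: LANA2026Report, §6.1 p. 31] -/
theorem kummerAt_mul (H : Subgroup (Gal K₀)) (a b : invariants (A := (AlgCl K₀)ˣ) H) :
    kummerAt K₀ H (Additive.ofMul (a * b)) = kummerAt K₀ H (Additive.ofMul a) + kummerAt K₀ H (Additive.ofMul b) :=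
  map_add (kummerAt K₀ H) (Additive.ofMul a) (Additive.ofMul b)

end Units

section CharZero

variable (K₀ : Type) [NontriviallyNormedField K₀] [CompleteSpace K₀] [IsUltrametricDist K₀] [CharZero K₀]

omit [CompleteSpace K₀] [IsUltrametricDist K₀] in
/-- **"`K_v^× = (K̄_v^×)^{G_v}`"** (§4.2 (b)): in characteristic zero the `G_v`-invariant units of `K̄_v` are
exactly the units coming from `K_v` (Galois invariants = base, `LanaLocalField.fixed_iff_mem_range`).
[cite: LANA2026Report, §4.2 (b) p. 26] -/
theorem mem_unitsInvariants_top_iff (u : (AlgCl K₀)ˣ) :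
    u ∈ invariants (A := (AlgCl K₀)ˣ) (⊤ : Subgroup (Gal K₀)) ↔
      (u : AlgCl K₀) ∈ Set.range (algebraMap K₀ (AlgCl K₀)) := by
  rw [← fixed_iff_mem_range, invariants, FixedPoints.mem_subgroup]
  constructor
  · intro h σ
    have hσ : σ • u = u := h ⟨σ, trivial⟩
    have hσ' := congrArg (fun v : (AlgCl K₀)ˣ => (v : AlgCl K₀)) hσ
    simpa only [units_coe_smul] using hσ'
  · intro h σ
    change (σ : Gal K₀) • u = u
    refine Units.ext ?_
    rw [units_coe_smul]
    exact h σ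

/-- **LANA §4.2 (b), second bullet, at level `G_v`**: the Kummer map `K_v^× = (K̄_v^×)^{G_v} → H¹(G_v, Λ(K̄_v^×))`
(injectivity = modelling note (iii)). [cite: LANA2026Report, §4.2 (b) p. 26] -/
def kummerBase :
    Additive (invariants (A := (AlgCl K₀)ˣ) (⊤ : Subgroup (Gal K₀))) →+
      groupCohomology.H1 (cyclotomeRep (A := (AlgCl K₀)ˣ) (⊤ : Subgroup (Gal K₀))) :=
  kummerAt K₀ ⊤

end CharZero

end AlgCl

end IUTFork

end Summit.ABC

end
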